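import Mathlib
import Summits.NavierStokesRegularity.NavierStokesRegularity.Theorems.TaoLadderRungTwoBreakOneShiftT4E5W136Defs
import Summits.NavierStokesRegularity.NavierStokesRegularity.Theorems.TaoLadderRungTwoBreakCircuitTableQuadTermLip
import Summits.NavierStokesRegularity.NavierStokesRegularity.Theorems.TaoLadderRungTwoBreakCircuitTableAbsSum
import Summits.NavierStokesRegularity.NavierStokesRegularity.Theorems.TaoLadderRungTwoBreakCircuitTableT4
import Summits.NavierStokesRegularity.NavierStokesRegularity.Theorems.TaoLadderRungTwoBreakOneShiftT4W76Rows
import HarnessLib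

/-!
# The one-shift instance T4 @ ε₀ = 1/20, W = 136: the frame / scalar / ROW arithmetic of
# `exists_surviving_dssWave_of_windowCert_v7s` in the kernel (exact rationals) — helper module of
# `…OneShiftT4E5W136` (cell harvest/h2-tao-ladder, seat p2; rung1/INSTANCE-SHEET-T4-0.1-W76.md (the T4 @ 0.05 instance follows the same sheet);
# support for K1(1) = `NoSurvivingDSSOne`, stmt-NavierStokesRegularity-20205)

MODEL lattice only (Tao-type averaged cascade with the comparable circuit table T4, scale ratio `21/20`);
nothing here is a statement about the Navier–Stokes equations; no item is closed.

Contents: `Λ₀ = bigLam (1/20) ∈ [1.1297, 1.1298]` (from `Λ₀² = 1.2762815625`), `Λ₀^136 = 1.2762815625^68`; `|α| ≤ 1` and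
`Σ|α|_i ≤ 2.16` for T4; the values of the closed-form frame functions of module `…OneShiftT4E5W136Defs` on the
wake / top shells and at the two edge shells; and the nine finite rows of `…_v7s` for this instance with
`q = 13/25` (`row_RBm1`, `row_RBW` via the envelope `quadTermLip_le_of_bounds`; `row_B`, `row_T`, `row_firstW`,
`row_firstWS`, `row_firstT`, `row_firstTS`, `row_1`, and the window row `row_qX`).  Python exact-rational twin
with the same constants: harvest/h2-tao-ladder rung1/num4c/inst_exact_rows.py (row T4E5W136: 92 checks, all OK).
-/

noncomputable section

-- the sub-problem namespace repeats the summit name by design (D-0017)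
set_option linter.dupNamespace false

namespace Summit.NavierStokesRegularity.NavierStokesRegularity.Theorems

namespace DSSOneShift

open Set Literature.Analysis.FluidPDE Literature.Analysis.FluidPDE.TaoCascade CertificateGlueOn
open OneShiftFrame

namespace T4E5W136

/-! ### `Λ₀ = (21/20)^{5/2}` and the table -/

/-- `1.1297 ≤ Λ₀ ≤ 1.1298` (`Λ₀² = 1.05⁵ = 1.2762815625`). [cite: Tao2016AveragedNS, §4 (4.1)] -/
theorem bigLam_e5_bounds : (11297 / 10000 : ℝ) ≤ bigLam (1 / 20) ∧ bigLam (1 / 20) ≤ 11298 / 10000 := by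
  have h2 : bigLam (1 / 20 : ℝ) ^ 2 = 12762815625 / 10000000000 := by rw [bigLam_sq (by norm_num)]; norm_num
  have hpos : 0 < bigLam (1 / 20 : ℝ) := bigLam_pos (by norm_num)
  constructor <;> nlinarith

/-- `Λ₀^136 = 1.2762815625^68` (even power: rational). [cite: Tao2016AveragedNS, §4 (4.1)] -/
theorem bigLam_e5_pow_136 : bigLam (1 / 20 : ℝ) ^ 136 = (12762815625 / 10000000000) ^ 68 := by
  rw [show (136 : ℕ) = 2 * 68 by norm_num, pow_mul, bigLam_sq (by norm_num)]; norm_num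

/-- Every structure constant of T4 has modulus `≤ 1`. [cite: Tao2016AveragedNS, §6.1; cell vocabulary (`IsComparableCoeff`), module …CircuitTableT4] -/
theorem abs_αT4_le_one (i₁ i₂ i₃ : Fin 4) (μ : ℤ × ℤ × ℤ) : |T4E5W136.αT4 i₁ i₂ i₃ μ| ≤ 1 := by
  have hT := inTableClass_circuitTable_T4 (ε₀ := 1 / 20) (by norm_num) (by norm_num)
  by_cases hμ : μ ∈ shiftSet
  · exact (hT.2.2 i₁ i₂ i₃ μ hμ).1
  · unfold αT4
    rw [circuitTable_eq_zero_of_not_mem _ _ _ _ _ i₁ i₂ i₃ μ hμ, abs_zero]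
    exact zero_le_one

/-- `Σ_{i₁i₂μ}|α_{i₁i₂iμ}| ≤ 2.16` for every mode of T4 at this `Λ₀` (`(2.1582, 0.701, 0.509, 1.6982)`). [cite: Tao2016AveragedNS, §4 (4.1); cell vocabulary, module …CircuitTableAbsSum] -/
theorem tableAbsSum_αT4_le (i : Fin 4) : tableAbsSum T4E5W136.αT4 i ≤ S := by
  obtain ⟨-, hΛhi⟩ := bigLam_e5_bounds
  have hpos : 0 < bigLam (1 / 20 : ℝ) := bigLam_pos (by norm_num)
  have hk : |bigLam (1 / 20)| * (309 / 500) ≤ 6983 / 10000 := by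
    rw [abs_of_pos hpos]; linarith
  obtain ⟨h0, h1, h2, h3⟩ := tableAbsSum_circuitTable 1 0.326 0.134 0.375 (bigLam (1 / 20) * 0.618)
  fin_cases i
  · exact h0.le.trans (by norm_num [S]; linarith)
  · exact h1.le.trans (by norm_num [S])
  · exact h2.le.trans (by norm_num [S])
  · exact h3.le.trans (by norm_num [S]; linarith)

/-- `0 ≤ Σ|α|_i`. [folklore] -/
theorem tableAbsSum_nonneg (i : Fin 4) : 0 ≤ tableAbsSum T4E5W136.αT4 i := by
  unfold tableAbsSum
  exact Finset.sum_nonneg fun _ _ => Finset.sum_nonneg fun _ _ => Finset.sum_nonneg fun _ _ => abs_nonneg _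

/-! ### Values of the frame functions -/


/-- [folklore] -/
theorem AT4_nonneg (k : ℤ) : 0 ≤ T4E5W136.AT4 k := by
  unfold AT4 Q βw gHi εR abart; split_ifs <;> positivity

/-- [folklore] -/
theorem RT4_nonneg (k : ℤ) : 0 ≤ T4E5W136.RT4 k := by
  have hpos : 0 < bigLam (1 / 20 : ℝ) := bigLam_pos (by norm_num)
  unfold RT4 S Q βw gHi abart; split_ifs <;> positivity

/-- [folklore] -/
theorem vmaxT4_nonneg (k : ℤ) : 0 ≤ T4E5W136.vmaxT4 k := by unfold vmaxT4; split_ifs <;> positivity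
/-- [folklore] -/
theorem χbT4_nonneg (k : ℤ) : 0 ≤ T4E5W136.χbT4 k := by unfold χbT4; split_ifs <;> positivity
/-- [folklore] -/
theorem χeT4_nonneg (k : ℤ) : 0 ≤ T4E5W136.χeT4 k := by unfold χeT4; split_ifs <;> positivity

/-- [folklore] -/
theorem wtT4_wake (n : ℕ) : T4E5W136.wtT4 (-(n : ℤ) - 1) = 1 * θw ^ (n + 1) := by
  have e : (-(-(n : ℤ) - 1)).toNat = n + 1 := by omega
  unfold wtT4; rw [if_pos (by omega), e, one_mul]

/-- [folklore] -/
theorem wtT4_top (j : ℕ) : T4E5W136.wtT4 ((136 : ℤ) + (j : ℤ)) = ωt * (1 / 2) ^ j := by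
  have e : ((136 : ℤ) + (j : ℤ) - 136).toNat = j := by omega
  unfold wtT4; rw [if_neg (by omega), if_pos (by omega), e]

/-- [folklore] -/
theorem tubeRT4_wake (n : ℕ) : T4E5W136.tubeRT4 (-(n : ℤ) - 1) = gHi ^ (n + 1) * (r₀ + κw * ((n : ℝ) + 1)) := by
  have e : (-(-(n : ℤ) - 1)).toNat = n + 1 := by omega
  unfold tubeRT4; rw [if_pos (by omega), e]; push_cast; ring

/-- [folklore] -/
theorem tubeRT4_top (j : ℕ) : T4E5W136.tubeRT4 ((136 : ℤ) + (j : ℤ)) = εR * (1 / 2) ^ j := by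
  have e : ((136 : ℤ) + (j : ℤ) - 136).toNat = j := by omega
  unfold tubeRT4; rw [if_neg (by omega), if_pos (by omega), e]

/-- [folklore] -/
theorem tubeCT4_wake (c₀ : Fin 4 → ℝ) (i : Fin 4) (n : ℕ) :
    T4E5W136.tubeCT4 c₀ i (-(n : ℤ) - 1) = ghat ^ (n + 1) * c₀ i := by
  have e : (-(-(n : ℤ) - 1)).toNat = n + 1 := by omega
  unfold tubeCT4; rw [if_pos (by omega), e]

/-- [folklore] -/
theorem tubeCT4_top (c₀ : Fin 4 → ℝ) (i : Fin 4) (j : ℕ) : T4E5W136.tubeCT4 c₀ i ((136 : ℤ) + (j : ℤ)) = 0 := by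
  unfold tubeCT4; rw [if_neg (by omega)]

/-- [folklore] -/
theorem AT4_wake (n : ℕ) : T4E5W136.AT4 (-(n : ℤ) - 1) = Q * βw ^ (n + 1) := by
  have e : (-(-(n : ℤ) - 1)).toNat = n + 1 := by omega
  unfold AT4; rw [if_pos (by omega), e]

/-- [folklore] -/
theorem AT4_top (j : ℕ) : T4E5W136.AT4 ((136 : ℤ) + (j : ℤ)) = εR * (1 / 2) ^ j := by
  have e : ((136 : ℤ) + (j : ℤ) - 136).toNat = j := by omega
  unfold AT4; rw [if_neg (by omega), if_pos (by omega), e]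

/-- [folklore] -/
theorem RT4_wake (j : ℕ) :
    T4E5W136.RT4 (-(j : ℤ) - 1) = (S * Q ^ 2 * βw ^ 2) * (βw ^ 2 * (bigLam (1 / 20))⁻¹) ^ (j + 1) := by
  have e : (-(-(j : ℤ) - 1)).toNat = j + 1 := by omega
  unfold RT4; rw [if_pos (by omega), e]

/-- [folklore] -/
theorem RT4_top (j : ℕ) : T4E5W136.RT4 ((136 : ℤ) + (j : ℤ)) =
    (S * abart ^ 2 * bigLam (1 / 20) ^ (136 : ℕ)) * (bigLam (1 / 20) * (1 / 2) ^ 2) ^ j := by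
  have e : ((136 : ℤ) + (j : ℤ) - 136).toNat = j := by omega
  unfold RT4; rw [if_neg (by omega), if_pos (by omega), e]

/-- The amplitude hulls near the bottom edge are `≤ Q β²`. [folklore] -/
theorem AT4_le_bot (k' : ℤ) (h1 : -1 - 1 ≤ k') (h2 : k' ≤ -1 + 1) : T4E5W136.AT4 k' ≤ Q * βw ^ 2 := by
  interval_cases k' <;> norm_num [AT4, Q, βw, gHi, T4W76.toNat_two]

/-- The amplitude hulls near the top edge are `≤ ā_t`. [folklore] -/
theorem AT4_le_top (k' : ℤ) (h1 : (136 : ℤ) - 1 ≤ k') (h2 : k' ≤ (136 : ℤ) + 1) : T4E5W136.AT4 k' ≤ abart := by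
  interval_cases k' <;> norm_num [AT4, abart, εR]

variable (bd : BoxData)

/-- [folklore] -/
theorem frame_W : ((T4E5W136.frame bd).W : ℤ) = 136 := by show ((136 : ℕ) : ℤ) = 136; norm_num
/-- [folklore] -/
theorem frame_W' : (frame bd).W = 136 := rfl
/-- [folklore] -/
theorem frame_τhi : (T4E5W136.frame bd).τhi = T4E5W136.τc + T4E5W136.rτ := rfl
/-- [folklore] -/
theorem frame_rτ : (T4E5W136.frame bd).rτ = rτ := rfl
/-- [folklore] -/
theorem frame_wt (k : ℤ) : (T4E5W136.frame bd).wt k = wtT4 k := rfl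
/-- [folklore] -/
theorem frame_tubeR (k : ℤ) : (T4E5W136.frame bd).tubeR k = tubeRT4 k := rfl
/-- [folklore] -/
theorem frame_tubeC (i : Fin 4) (k : ℤ) : (T4E5W136.frame bd).tubeC i k = tubeCT4 (fun i => bd.yc i 0) i k := rfl
/-- [folklore] -/
theorem wtT4_m1 : T4E5W136.wtT4 (-1) = θw := by norm_num [wtT4]
/-- [folklore] -/
theorem wtT4_136 : wtT4 136 = ωt := by norm_num [wtT4]
/-- [folklore] -/
theorem τhi_nonneg : (0 : ℝ) ≤ T4E5W136.τc + T4E5W136.rτ := by unfold τc rτ; norm_num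

/-- The distance coefficients near the bottom edge are in `[0, θ²]`. [folklore] -/
theorem D_le_bot (k' : ℤ) (h1 : -1 - 1 ≤ k') (h2 : k' ≤ -1 + 1) :
    (0 ≤ (if (T4E5W136.frame bd).InWindow k' then
        vmaxT4 k' + χbT4 k' * (T4E5W136.frame bd).wt (-1) + χeT4 k' * (T4E5W136.frame bd).wt (T4E5W136.frame bd).W else (T4E5W136.frame bd).wt k')) ∧
    (if (T4E5W136.frame bd).InWindow k' then
        vmaxT4 k' + χbT4 k' * (T4E5W136.frame bd).wt (-1) + χeT4 k' * (T4E5W136.frame bd).wt (T4E5W136.frame bd).W else (T4E5W136.frame bd).wt k')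
      ≤ θw ^ 2 := by
  interval_cases k' <;>
    norm_num [OneShiftFrame.InWindow, frame, wtT4, vmaxT4, χbT4, χeT4, θw, gHi, ωt, T4W76.toNat_two]

/-- The distance coefficients near the top edge are in `[0, 1.02e-24]`. [folklore] -/
theorem D_le_top (k' : ℤ) (h1 : ((T4E5W136.frame bd).W : ℤ) - 1 ≤ k') (h2 : k' ≤ ((T4E5W136.frame bd).W : ℤ) + 1) :
    (0 ≤ (if (T4E5W136.frame bd).InWindow k' then
        vmaxT4 k' + χbT4 k' * (T4E5W136.frame bd).wt (-1) + χeT4 k' * (T4E5W136.frame bd).wt (T4E5W136.frame bd).W else (T4E5W136.frame bd).wt k')) ∧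
    (if (T4E5W136.frame bd).InWindow k' then
        vmaxT4 k' + χbT4 k' * (T4E5W136.frame bd).wt (-1) + χeT4 k' * (T4E5W136.frame bd).wt (T4E5W136.frame bd).W else (T4E5W136.frame bd).wt k')
      ≤ 102 / 10 ^ 26 := by
  rw [frame_W] at h1 h2
  interval_cases k' <;>
    norm_num [OneShiftFrame.InWindow, frame, wtT4, vmaxT4, χbT4, χeT4, θw, gHi, ωt, T4W76.toNat_two]

/-- [folklore] -/
theorem AT4_le_top' (k' : ℤ) (h1 : ((T4E5W136.frame bd).W : ℤ) - 1 ≤ k') (h2 : k' ≤ ((T4E5W136.frame bd).W : ℤ) + 1) :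
    T4E5W136.AT4 k' ≤ abart := by
  rw [frame_W] at h1 h2; exact AT4_le_top k' h1 h2

/-! ### The nine rows of `…_v7s` for this instance (`q = 13/25`) -/

/-- Row `hRBm1` (table-sparse rate at the wake edge). [cite: Tao2016AveragedNS, §4 (4.8); cell vocabulary, harvest/h2-tao-ladder rung1/INSTANCE-SHEET-T4-0.1-W76.md (the T4 @ 0.05 instance follows the same sheet)] -/
theorem row_RBm1 (i : Fin 4) : quadTermLip (1 / 20) αT4 AT4 AT4 i (-1) ≤ 2 * RT4 (-1) := by
  have hε : (0 : ℝ) < 1 + 1 / 20 := by norm_num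
  have hΛ1 : 1 ≤ bigLam (1 / 20 : ℝ) := one_le_bigLam (by norm_num)
  have hpos : 0 < bigLam (1 / 20 : ℝ) := bigLam_pos (by norm_num)
  have hS := tableAbsSum_αT4_le i
  have henv := quadTermLip_le_of_bounds hε hΛ1 αT4 (n := -1) (fun k' _ _ => AT4_nonneg k')
    (fun k' _ _ => AT4_nonneg k') AT4_le_bot AT4_le_bot i
  have hR := RT4_wake 0
  norm_num at hR
  rw [zpow_neg_one] at henv
  rw [hR]
  have hL0 : 0 ≤ (bigLam (1 / 20 : ℝ))⁻¹ := by positivity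
  have hTL : tableAbsSum αT4 i * (bigLam (1 / 20))⁻¹ ≤ S * (bigLam (1 / 20))⁻¹ :=
    mul_le_mul_of_nonneg_right hS hL0
  unfold S Q βw gHi at *
  nlinarith [hTL, henv, hL0]

/-- Row `hRBW` (table-sparse rate at the top edge). [cite: Tao2016AveragedNS, §4 (4.8); cell vocabulary, harvest/h2-tao-ladder rung1/INSTANCE-SHEET-T4-0.1-W76.md (the T4 @ 0.05 instance follows the same sheet)] -/
theorem row_RBW (i : Fin 4) :
    quadTermLip (1 / 20) αT4 AT4 AT4 i ((frame bd).W : ℤ) ≤ 2 * RT4 ((frame bd).W : ℤ) := by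
  have hε : (0 : ℝ) < 1 + 1 / 20 := by norm_num
  have hΛ1 : 1 ≤ bigLam (1 / 20 : ℝ) := one_le_bigLam (by norm_num)
  have hS := tableAbsSum_αT4_le i
  have henv := quadTermLip_le_of_bounds hε hΛ1 αT4 (n := ((frame bd).W : ℤ)) (fun k' _ _ => AT4_nonneg k')
    (fun k' _ _ => AT4_nonneg k') (AT4_le_top' bd) (AT4_le_top' bd) i
  have hR := RT4_top 0
  simp only [Nat.cast_zero, add_zero, pow_zero, mul_one] at hR
  rw [frame_W] at henv ⊢
  rw [zpow_ofNat, bigLam_e5_pow_136] at henv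
  rw [hR, bigLam_e5_pow_136]
  unfold S abart at *
  nlinarith [hS, henv]

/-- Row `hrowB` (contraction row at the wake edge `k = -1`, reading the window bottom). [cite: Tao2016AveragedNS, §4 (4.8), §5.3; cell vocabulary, harvest/h2-tao-ladder rung1/STAGE3-BANACH.md §2] -/
theorem row_B (i : Fin 4) :
    gHi * (701 / 10 ^ 12 + 377 / 10 ^ 7 * (frame bd).wt (-1) + 1 / 10 ^ 60 * (frame bd).wt (frame bd).W) +
      AT4 0 * (102 / 10 ^ 11 + 525 / 10 ^ 18 * (frame bd).wt (-1) + 1 / 10 ^ 60 * (frame bd).wt (frame bd).W) +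
      (frame bd).τhi * quadTermLip (1 / 20) αT4 AT4
        (fun k' => if (frame bd).InWindow k' then
          vmaxT4 k' + χbT4 k' * (frame bd).wt (-1) + χeT4 k' * (frame bd).wt (frame bd).W else (frame bd).wt k')
        i (-1) ≤ 13 / 25 * (frame bd).wt (-1) := by
  have hε : (0 : ℝ) < 1 + 1 / 20 := by norm_num
  have hΛ1 : 1 ≤ bigLam (1 / 20 : ℝ) := one_le_bigLam (by norm_num)
  have hpos : 0 < bigLam (1 / 20 : ℝ) := bigLam_pos (by norm_num)
  have hS := tableAbsSum_αT4_le i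
  have hS0 := tableAbsSum_nonneg i
  have henv := quadTermLip_le_of_bounds hε hΛ1 αT4 (n := -1) (fun k' _ _ => AT4_nonneg k')
    (fun k' h1 h2 => (D_le_bot bd k' h1 h2).1) AT4_le_bot (fun k' h1 h2 => (D_le_bot bd k' h1 h2).2) i
  rw [zpow_neg_one] at henv
  have hL1 : (bigLam (1 / 20 : ℝ))⁻¹ ≤ 1 := inv_le_one_of_one_le₀ hΛ1
  have hL0 : 0 ≤ (bigLam (1 / 20 : ℝ))⁻¹ := by positivity
  have hTL : tableAbsSum αT4 i * (bigLam (1 / 20))⁻¹ ≤ S * 1 := mul_le_mul hS hL1 hL0 (hS0.trans hS)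
  have key := mul_le_mul_of_nonneg_left henv (τhi_nonneg)
  have hA0 : AT4 0 = 70072 / 10 ^ 5 := by norm_num [AT4]
  rw [frame_τhi]
  simp only [frame_wt, frame_W, wtT4_m1, wtT4_136, hA0] at key ⊢
  unfold S Q βw θw gHi ωt τc rτ at *
  nlinarith [key, hTL]

/-- Row `hrowT` (contraction row at the top edge `k = W`, reading the window top). [cite: Tao2016AveragedNS, §4 (4.8), §5.3; cell vocabulary, harvest/h2-tao-ladder rung1/STAGE3-BANACH.md §2] -/
theorem row_T (i : Fin 4) :
    gHi * ((frame bd).wt (((frame bd).W : ℤ) + 1) + RT4 (((frame bd).W : ℤ) + 1) * (frame bd).rτ) +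
      AT4 (((frame bd).W : ℤ) + 1) *
        (102 / 10 ^ 11 + 525 / 10 ^ 18 * (frame bd).wt (-1) + 1 / 10 ^ 60 * (frame bd).wt (frame bd).W) +
      (frame bd).τhi * quadTermLip (1 / 20) αT4 AT4
        (fun k' => if (frame bd).InWindow k' then
          vmaxT4 k' + χbT4 k' * (frame bd).wt (-1) + χeT4 k' * (frame bd).wt (frame bd).W else (frame bd).wt k')
        i (frame bd).W ≤ 13 / 25 * (frame bd).wt (frame bd).W := by
  have hε : (0 : ℝ) < 1 + 1 / 20 := by norm_num
  have hΛ1 : 1 ≤ bigLam (1 / 20 : ℝ) := one_le_bigLam (by norm_num)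
  have hpos : 0 < bigLam (1 / 20 : ℝ) := bigLam_pos (by norm_num)
  obtain ⟨-, hΛhi⟩ := bigLam_e5_bounds
  have hS := tableAbsSum_αT4_le i
  have hS0 := tableAbsSum_nonneg i
  have henv := quadTermLip_le_of_bounds hε hΛ1 αT4 (n := ((frame bd).W : ℤ)) (fun k' _ _ => AT4_nonneg k')
    (fun k' h1 h2 => (D_le_top bd k' h1 h2).1) (AT4_le_top' bd) (fun k' h1 h2 => (D_le_top bd k' h1 h2).2) i
  have key := mul_le_mul_of_nonneg_left henv (τhi_nonneg)
  have hw137 : wtT4 (136 + 1) = ωt * (1 / 2) ^ 1 := by exact_mod_cast wtT4_top 1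
  have hA137 : AT4 (136 + 1) = εR * (1 / 2) ^ 1 := by exact_mod_cast AT4_top 1
  have hR137 : RT4 (136 + 1) = (S * abart ^ 2 * bigLam (1 / 20) ^ (136 : ℕ)) * (bigLam (1 / 20) * (1 / 2) ^ 2) ^ 1 := by
    exact_mod_cast RT4_top 1
  rw [frame_τhi, frame_rτ]
  simp only [frame_wt, frame_W, wtT4_m1, wtT4_136, hw137, hA137, hR137, pow_one, zpow_ofNat,
    bigLam_e5_pow_136] at key ⊢
  have hTΛ : tableAbsSum αT4 i ≤ S := hS
  have hRb : S * abart ^ 2 * ((12762815625 : ℝ) / 10000000000) ^ 68 * (bigLam (1 / 20) * (1 / 2) ^ 2) ≤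
      S * abart ^ 2 * ((12762815625 : ℝ) / 10000000000) ^ 68 * (11298 / 10000 * (1 / 2) ^ 2) := by
    unfold S abart; gcongr
  unfold S abart θw gHi ωt εR τc rτ at *
  nlinarith [key, hTΛ, hRb]

/-- Row `hfirstW` (first interior wake contraction row `k = -2`). [cite: Tao2016AveragedNS, §4 (4.8); cell vocabulary, harvest/h2-tao-ladder rung1/STAGE3-BANACH.md §2 (θ_w)] -/
theorem row_firstW (i : Fin 4) :
    gHi * (1 * θw + (S * Q ^ 2 * βw ^ 2) * (βw ^ 2 * (bigLam (1 / 20))⁻¹) * (frame bd).rτ) +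
      Q * βw * (102 / 10 ^ 11 + 525 / 10 ^ 18 * (frame bd).wt (-1) + 1 / 10 ^ 60 * (frame bd).wt (frame bd).W) +
      (frame bd).τhi * (2 * tableAbsSum αT4 i * (bigLam (1 / 20))⁻¹ ^ 2 * (1 * θw ^ 3) * (Q * βw ^ 3)) ≤
      13 / 25 * (1 * θw ^ 2) := by
  have hΛ1 : 1 ≤ bigLam (1 / 20 : ℝ) := one_le_bigLam (by norm_num)
  have hpos : 0 < bigLam (1 / 20 : ℝ) := bigLam_pos (by norm_num)
  have hS := tableAbsSum_αT4_le i
  have hS0 := tableAbsSum_nonneg i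
  have hL1 : (bigLam (1 / 20 : ℝ))⁻¹ ≤ 1 := inv_le_one_of_one_le₀ hΛ1
  have hL0 : 0 ≤ (bigLam (1 / 20 : ℝ))⁻¹ := by positivity
  have hTL2 : tableAbsSum αT4 i * (bigLam (1 / 20))⁻¹ ^ 2 ≤ S * 1 :=
    mul_le_mul hS (by nlinarith) (by positivity) (hS0.trans hS)
  rw [frame_τhi, frame_rτ]
  simp only [frame_wt, frame_W, wtT4_m1, wtT4_136]
  unfold S Q βw θw gHi ωt τc rτ at *
  nlinarith [hTL2, hL1, hL0]

/-- Row `hfirstWS` (wake self-map row). [cite: Tao2016AveragedNS, §4 (4.8); cell vocabulary, harvest/h2-tao-ladder rung1/STAGE2-LEMMA.md §5 (Lemma 4a)] -/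
theorem row_firstWS :
    cmax * max (gHi - ghat) (ghat - gLo) * ghat +
      (frame bd).τhi * ((S * Q ^ 2 * βw ^ 2) * (βw ^ 2 * (bigLam (1 / 20))⁻¹) ^ 2) ≤ κw * gHi ^ 2 := by
  have hΛ1 : 1 ≤ bigLam (1 / 20 : ℝ) := one_le_bigLam (by norm_num)
  have hpos : 0 < bigLam (1 / 20 : ℝ) := bigLam_pos (by norm_num)
  have hL1 : (bigLam (1 / 20 : ℝ))⁻¹ ≤ 1 := inv_le_one_of_one_le₀ hΛ1
  have hL0 : 0 ≤ (bigLam (1 / 20 : ℝ))⁻¹ := by positivity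
  have hL2 : (bigLam (1 / 20 : ℝ))⁻¹ ^ 2 ≤ 1 := pow_le_one₀ hL0 hL1
  have hmax : max (gHi - ghat) (ghat - gLo) = 11 / 10 ^ 10 := by norm_num [gHi, ghat, gLo]
  rw [hmax, frame_τhi]
  unfold cmax ghat S Q βw gHi κw τc rτ
  nlinarith [hL2]

/-- Row `hfirstT` (first interior top contraction row `k = W+1`). [cite: Tao2016AveragedNS, §4 (4.8); cell vocabulary, harvest/h2-tao-ladder rung1/STAGE3-BANACH.md §2 (θ_t)] -/
theorem row_firstT (i : Fin 4) :
    gHi * (ωt * (1 / 2) ^ 2 +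
        (S * abart ^ 2 * bigLam (1 / 20) ^ (frame bd).W) * (bigLam (1 / 20) * (1 / 2) ^ 2) ^ 2 * (frame bd).rτ) +
      (abart * (1 / 2)) * (1 / 2) ^ 2 *
        (102 / 10 ^ 11 + 525 / 10 ^ 18 * (frame bd).wt (-1) + 1 / 10 ^ 60 * (frame bd).wt (frame bd).W) +
      (frame bd).τhi * (2 * tableAbsSum αT4 i * bigLam (1 / 20) ^ ((frame bd).W + 1) * ωt * (abart * (1 / 2))) ≤
      13 / 25 * (ωt * (1 / 2)) := by
  have hpos : 0 < bigLam (1 / 20 : ℝ) := bigLam_pos (by norm_num)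
  obtain ⟨-, hΛhi⟩ := bigLam_e5_bounds
  have h2 : bigLam (1 / 20 : ℝ) ^ 2 = 12762815625 / 10000000000 := by rw [bigLam_sq (by norm_num)]; norm_num
  have hS := tableAbsSum_αT4_le i
  have hS0 := tableAbsSum_nonneg i
  have hTΛ : tableAbsSum αT4 i * bigLam (1 / 20) ≤ S * (11298 / 10000) := mul_le_mul hS hΛhi hpos.le (hS0.trans hS)
  have h137 : bigLam (1 / 20 : ℝ) ^ ((frame bd).W + 1) = (12762815625 / 10000000000) ^ 68 * bigLam (1 / 20) := by
    rw [frame_W', pow_succ, bigLam_e5_pow_136]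
  have h136 : bigLam (1 / 20 : ℝ) ^ (frame bd).W = (12762815625 / 10000000000) ^ 68 := by
    rw [frame_W', bigLam_e5_pow_136]
  rw [h137, h136, frame_τhi, frame_rτ]
  simp only [frame_wt, frame_W, wtT4_m1, wtT4_136]
  unfold S abart θw gHi ωt τc rτ at *
  nlinarith [hTΛ, h2]

/-- Row `hfirstTS` (top self-map row). [cite: Tao2016AveragedNS, §4 (4.8); cell vocabulary, harvest/h2-tao-ladder rung1/STAGE2-LEMMA.md §5 (Lemma 4b)] -/
theorem row_firstTS :
    gHi * (εR * (1 / 2)) + (frame bd).τhi * (S * abart ^ 2 * bigLam (1 / 20) ^ (frame bd).W) ≤ εR := by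
  rw [frame_τhi, frame_W', bigLam_e5_pow_136]
  unfold gHi εR S abart τc rτ
  norm_num

/-- Row `hrow1` (wake entry row). [cite: Tao2016AveragedNS, §5.3; cell vocabulary, harvest/h2-tao-ladder rung1/STAGE2-LEMMA.md §5] -/
theorem row_1 : 137 / 10 ^ 7 + (frame bd).τhi * RT4 (-1) ≤ (frame bd).tubeR (-1) := by
  have hΛ1 : 1 ≤ bigLam (1 / 20 : ℝ) := one_le_bigLam (by norm_num)
  have hpos : 0 < bigLam (1 / 20 : ℝ) := bigLam_pos (by norm_num)
  have hL1 : (bigLam (1 / 20 : ℝ))⁻¹ ≤ 1 := inv_le_one_of_one_le₀ hΛ1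
  have hR := RT4_wake 0
  norm_num at hR
  have ht : tubeRT4 (-1) = gHi * (r₀ + κw) := by norm_num [tubeRT4]
  rw [frame_τhi, frame_tubeR, hR, ht]
  unfold S Q βw gHi r₀ κw τc rτ
  nlinarith [hL1]

/-- Window row `hqX`. [cite: Tao2016AveragedNS, §5.3; cell vocabulary, harvest/h2-tao-ladder rung1/STAGE3-BANACH.md §2 (row 1 of L̃)] -/
theorem row_qX :
    222 / 10 ^ 5 + 116 / 10 ^ 5 * (frame bd).wt (-1) + 16805 * 10 ^ 20 * (frame bd).wt (frame bd).W ≤ 13 / 25 := by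
  simp only [frame_wt, frame_W, wtT4_m1, wtT4_136]
  unfold θw gHi ωt; norm_num

end T4E5W136

end DSSOneShift

end Summit.NavierStokesRegularity.NavierStokesRegularity.Theorems
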